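import Literature.NumberTheory.EllipticCurves.TwoDescentKummerBridge
import Literature.NumberTheory.EllipticCurves.SelmerLocalConditionGoodReductionProofs
import Literature.NumberTheory.EllipticCurves.KummerUnramifiedConverse
import HarnessLib

/-!
# The class of `H¹(K, E[2])` with prescribed `2`-descent components, and its local condition at the
# good odd places

For an elliptic curve `E/K` (`char K = 0`) with rational `2`-torsion `T₁, T₂, T₃` (abscissae
`e₁, e₂, e₃`), the tree reads a class `c ∈ H¹(K, E[2])` through its two components
`(H¹(χ₁) c, H¹(χ₂) c) ∈ H¹(K, μ₂)² ≃ (Kˣ/Kˣ²)²` (`TwoDescentTwoTorsionCharacter.lean`, Kummer theory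
`kummerEquiv`), an INJECTION (`eq_zero_of_twoTorsionCharH1_eq_zero`). Silverman's Prop. X.1.4 uses
`E[2] ≅ μ₂ × μ₂` both ways: every pair `(b₁, b₂) ∈ (Kˣ/Kˣ²)²` is the component pair of a class (the
class of the homogeneous space `b₁z₁² - b₂z₂² = e₂ - e₁, …`). This file supplies that SURJECTIVITY and
the behaviour of the resulting classes at the good places:

* `muToTwoTorsion h : μ₂ →+ E[2]` — the section `-1 ↦ T₁` of the character of the OTHER torsion
  points (`χ₁ ∘ ι_{T₁} = 0`, `χ₂ ∘ ι_{T₁} = id`: `twoTorsionChar_muToTwoTorsion_self/_of_ne`),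
  `Γ_K`-equivariant (both actions trivial); `muToTwoTorsionHom`, and
  `muToTwoTorsionH1 h : H¹(K, μ₂) →+ H¹(K, E[2])` the induced map, computed on cocycles;
* `twoTorsionCharH1_muToTwoTorsionH1_self/_of_ne` — `H¹(χ₁) ∘ H¹(ι_{T₁}) = 0`,
  `H¹(χ₁) ∘ H¹(ι_{T'}) = id` for `T' ≠ T₁`;
* **`twoDescentClass h a b := H¹(ι_{T₂})(δ a) + H¹(ι_{T₁})(δ b)`** (`δ = kummerMap K 2`), THE class with
  components `([a], [b])`: `kummerEquiv_twoTorsionCharH1_twoDescentClass` (`= [a]`),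
  `kummerEquiv_twoTorsionCharH1_swap_twoDescentClass` (`= [b]`), and uniqueness
  `eq_twoDescentClass_of_kummerEquiv_eq` (any class with these components is it);
* **the good places** (number field `K`, finite place `v ∤ 2` of good reduction, `a ∈ 𝓞 K` a
  `v`-unit): `muToTwoTorsionH1_kummerMap_mem_selmerLocalKer` — `H¹(ι_T)(δ a)` satisfies the local Selmer
  condition at `v`: its cocycle `τ ↦ ι_T(τ(√a)/√a)` vanishes on the inertia groups above `v`
  (Kummer extensions by roots of units are unramified, Lang *FDG* Ch. 6 Prop. 1.3, tree
  `absoluteGaloisGroup_inertia_fixes_root_of_not_mem`), and at a good place `v ∤ n` the local Selmer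
  condition IS "unramified" (Gross 1991 (7.1), tree `oneCocycleClass_mem_selmerLocalKer_iff`); hence
  `twoDescentClass_mem_selmerLocalKer_of_not_mem` — **the class of a pair of `v`-units `(a, b)` satisfies
  the local condition at every good odd place `v`** (Silverman X.1.4: "`ord_v(b₁), ord_v(b₂)` even ⟹
  `(b₁, b₂) ∈ δ(E(K_v))` for `v ∉ S`", i.e. `K(S, 2)²` contains the image at the good places).

Theorems and definitions with bodies; no named fact. Cell `bsd-monsky` (prover-B): the input of the
LOWER bound `#Sel⁽²⁾(E_n/ℚ) ≥ 2^{2+s(n)}` of Monsky's `2`-Selmer formula (appendix to Heath-Brown 1994).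

## References

* [SilvermanAEC2009] J. H. Silverman, *The Arithmetic of Elliptic Curves*, 2nd ed., GTM 106,
  Springer 2009, Thm. X.1.1, Prop. X.1.4, VIII.§2, X.§4 (Thm. X.4.2, Cor. X.4.4).
* [Lang1983] S. Lang, *Fundamentals of Diophantine Geometry*, Springer 1983, Ch. 6 Prop. 1.3.
* [GrossLMS1991] B. H. Gross, *Kolyvagin's work on modular elliptic curves*, LMS LN 153 (1991), §7 (7.1).
* [SerreGaloisCohomology1997] J.-P. Serre, *Galois Cohomology*, Springer 1997, I §2.4, II §1.2.
-/

noncomputable section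

open scoped Classical

universe u

namespace WeierstrassCurve

open Literature.NumberTheory.GaloisRepresentations Literature.NumberTheory.EllipticCurves Field
open WeierstrassCurve.Affine DiscreteGaloisModule

variable {K : Type u} [Field K] [CharZero K] (W : WeierstrassCurve K) [W.IsElliptic] {e₁ e₂ e₃ : K}

/-! ### `μ₂ = {±1}` -/

omit [CharZero K] in
/-- An element of `μ₂(K̄)` is `1` or `-1`. [cite: SerreGaloisCohomology1997, II §1.2] -/
theorem muVal_two_eq_one_or (v : MuCarrier K 2) : muVal K 2 v = 1 ∨ muVal K 2 v = -1 := by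
  have hv : ((muVal K 2 v : (AlgebraicClosure K)ˣ) : AlgebraicClosure K) *
      (muVal K 2 v : AlgebraicClosure K) = 1 := by
    have := congrArg Units.val (muVal_pow_eq_one K 2 v)
    simpa [pow_two] using this
  rcases mul_self_eq_one_iff.mp hv with h1 | h1
  · exact Or.inl (Units.ext h1)
  · exact Or.inr (Units.ext (by rw [h1, Units.val_neg, Units.val_one]))

/-- `-1 ≠ 1` in `K̄ˣ` (characteristic `0`). [folklore] -/
private theorem neg_one_ne_one_units_algebraicClosure : (-1 : (AlgebraicClosure K)ˣ) ≠ 1 := by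
  intro h
  have h' := congrArg Units.val h
  rw [Units.val_neg, Units.val_one] at h'
  have : (2 : AlgebraicClosure K) = 0 := by linear_combination -h'
  exact two_ne_zero this

/-! ### The section `ι_{T₁} : μ₂ → E[2]`, `-1 ↦ T₁` -/

/-- The map `μ₂ → E[2]` sending `1 ↦ O` and `-1 ↦ T₁ = (e₁, *)` (values in the `2`-torsion of
`E(K̄)`), a section of the character of any other rational `2`-torsion point.
[cite: SilvermanAEC2009, Prop. X.1.4] -/
def muToTwoTorsionFun (h : W.toAffine.SplitTwoTorsion e₁ e₂ e₃) (v : MuCarrier K 2) : geomTorsion W 2 :=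
  if muVal K 2 v = 1 then 0 else ⟨W.geomTwoTorsion h, W.geomTwoTorsion_mem h⟩

/-- `ι_{T₁}(v) = O` when `v = 1`. [cite: SilvermanAEC2009, Prop. X.1.4] -/
theorem muToTwoTorsionFun_of_eq_one (h : W.toAffine.SplitTwoTorsion e₁ e₂ e₃) {v : MuCarrier K 2}
    (hv : muVal K 2 v = 1) : W.muToTwoTorsionFun h v = 0 := by
  rw [muToTwoTorsionFun, if_pos hv]

/-- `ι_{T₁}(v) = T₁` when `v = -1`. [cite: SilvermanAEC2009, Prop. X.1.4] -/
theorem muToTwoTorsionFun_of_eq_neg_one (h : W.toAffine.SplitTwoTorsion e₁ e₂ e₃) {v : MuCarrier K 2}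
    (hv : muVal K 2 v = -1) :
    W.muToTwoTorsionFun h v = ⟨W.geomTwoTorsion h, W.geomTwoTorsion_mem h⟩ := by
  rw [muToTwoTorsionFun, if_neg (by rw [hv]; exact neg_one_ne_one_units_algebraicClosure)]

/-- `ι_{T₁}` is additive (`T₁ + T₁ = O`). [cite: SilvermanAEC2009, Prop. X.1.4] -/
theorem muToTwoTorsionFun_add (h : W.toAffine.SplitTwoTorsion e₁ e₂ e₃) (v w : MuCarrier K 2) :
    W.muToTwoTorsionFun h (v + w) = W.muToTwoTorsionFun h v + W.muToTwoTorsionFun h w := by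
  have hTT : (⟨W.geomTwoTorsion h, W.geomTwoTorsion_mem h⟩ : geomTorsion W 2) +
      ⟨W.geomTwoTorsion h, W.geomTwoTorsion_mem h⟩ = 0 :=
    Subtype.ext (W.geomTwoTorsion_add_self h)
  rcases muVal_two_eq_one_or v with hv | hv <;> rcases muVal_two_eq_one_or w with hw | hw
  · rw [W.muToTwoTorsionFun_of_eq_one h hv, W.muToTwoTorsionFun_of_eq_one h hw,
      W.muToTwoTorsionFun_of_eq_one h (by rw [muVal_add, hv, hw, one_mul]), add_zero]
  · rw [W.muToTwoTorsionFun_of_eq_one h hv, W.muToTwoTorsionFun_of_eq_neg_one h hw,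
      W.muToTwoTorsionFun_of_eq_neg_one h (by rw [muVal_add, hv, hw, one_mul]), zero_add]
  · rw [W.muToTwoTorsionFun_of_eq_neg_one h hv, W.muToTwoTorsionFun_of_eq_one h hw,
      W.muToTwoTorsionFun_of_eq_neg_one h (by rw [muVal_add, hv, hw, mul_one]), add_zero]
  · rw [W.muToTwoTorsionFun_of_eq_neg_one h hv, W.muToTwoTorsionFun_of_eq_neg_one h hw,
      W.muToTwoTorsionFun_of_eq_one h (by rw [muVal_add, hv, hw]; simp), hTT]

/-- **The section `ι_{T₁} : μ₂ →+ E[2]`**, `-1 ↦ T₁`. [cite: SilvermanAEC2009, Prop. X.1.4] -/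
def muToTwoTorsion (h : W.toAffine.SplitTwoTorsion e₁ e₂ e₃) : MuCarrier K 2 →+ geomTorsion W 2 :=
  AddMonoidHom.mk' (W.muToTwoTorsionFun h) (W.muToTwoTorsionFun_add h)

/-- Unfolding `muToTwoTorsion`. [cite: SilvermanAEC2009, Prop. X.1.4] -/
theorem muToTwoTorsion_apply (h : W.toAffine.SplitTwoTorsion e₁ e₂ e₃) (v : MuCarrier K 2) :
    W.muToTwoTorsion h v = W.muToTwoTorsionFun h v :=
  rfl

/-- `ι_{T₁}(v) = O` when `v = 1`. [cite: SilvermanAEC2009, Prop. X.1.4] -/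
theorem muToTwoTorsion_of_muVal_eq_one (h : W.toAffine.SplitTwoTorsion e₁ e₂ e₃) {v : MuCarrier K 2}
    (hv : muVal K 2 v = 1) : W.muToTwoTorsion h v = 0 :=
  W.muToTwoTorsionFun_of_eq_one h hv

/-- **`ι_{T₁}` is `Γ_K`-equivariant** (both actions are trivial: `Γ_K` fixes `±1` and the rational
point `T₁`). [cite: SilvermanAEC2009, Prop. X.1.4] -/
theorem muToTwoTorsion_smul (h : W.toAffine.SplitTwoTorsion e₁ e₂ e₃) (σ : absoluteGaloisGroup K)
    (v : MuCarrier K 2) :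
    W.muToTwoTorsion h (DiscreteGaloisModule.mu K 2 σ v) = σ • W.muToTwoTorsion h v := by
  rw [mu_two_apply_eq, muToTwoTorsion_apply]
  apply Subtype.ext
  rw [Literature.NumberTheory.EllipticCurves.AddSubgroup.torsionBy.coe_smul]
  rcases muVal_two_eq_one_or v with hv | hv
  · rw [W.muToTwoTorsionFun_of_eq_one h hv, AddSubgroup.coe_zero, smul_zero]
  · rw [W.muToTwoTorsionFun_of_eq_neg_one h hv, smul_geomTwoTorsion]

/-- **`χ₁ ∘ ι_{T₁} = 0`**: the character of `T₁` kills the section at `T₁` (`χ₁(T₁) = 1`).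
[cite: SilvermanAEC2009, Thm. X.1.1, Prop. X.1.4] -/
theorem twoTorsionChar_muToTwoTorsion_self (h : W.toAffine.SplitTwoTorsion e₁ e₂ e₃) (v : MuCarrier K 2) :
    W.twoTorsionChar h (W.muToTwoTorsion h v) = 0 := by
  apply muVal_injective K 2
  rw [twoTorsionChar_apply, muVal_twoTorsionCharFun, muVal_zero, muToTwoTorsion_apply]
  rcases muVal_two_eq_one_or v with hv | hv
  · rw [W.muToTwoTorsionFun_of_eq_one h hv, ZeroMemClass.coe_zero, if_pos (Or.inl rfl)]
  · rw [W.muToTwoTorsionFun_of_eq_neg_one h hv, if_pos (Or.inr rfl)]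

/-- **`χ₁ ∘ ι_{T'} = id` for a DIFFERENT rational `2`-torsion point `T' = (e₁', *)`, `e₁' ≠ e₁`**
(`χ₁(T') = -1`). [cite: SilvermanAEC2009, Thm. X.1.1, Prop. X.1.4] -/
theorem twoTorsionChar_muToTwoTorsion_of_ne (h : W.toAffine.SplitTwoTorsion e₁ e₂ e₃) {e₁' e₂' e₃' : K}
    (h' : W.toAffine.SplitTwoTorsion e₁' e₂' e₃') (hne : e₁ ≠ e₁') (v : MuCarrier K 2) :
    W.twoTorsionChar h (W.muToTwoTorsion h' v) = v := by
  apply muVal_injective K 2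
  rw [twoTorsionChar_apply, muVal_twoTorsionCharFun, muToTwoTorsion_apply]
  rcases muVal_two_eq_one_or v with hv | hv
  · rw [W.muToTwoTorsionFun_of_eq_one h' hv, ZeroMemClass.coe_zero, if_pos (Or.inl rfl), hv]
  · rw [W.muToTwoTorsionFun_of_eq_neg_one h' hv, hv, if_neg]
    rw [not_or]
    exact ⟨W.geomTwoTorsion_ne_zero h', fun heq => hne ((W.geomTwoTorsion_eq_iff h' h).mp heq).symm⟩

/-! ### The induced map `H¹(ι_{T₁}) : H¹(K, μ₂) → H¹(K, E[2])` -/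

/-- The `Γ_K`-equivariant map `ι_{T₁} : μ₂ → E[2]` as a morphism in Mathlib's category `TopRep ℤ Γ_K`
(source `μ₂` restricted along `id`, target `E[2]` with its discrete topology), in the shape consumed
by `ContinuousCohomology.map`. [cite: SerreGaloisCohomology1997, I §2.4] -/
def muToTwoTorsionHom (h : W.toAffine.SplitTwoTorsion e₁ e₂ e₃) :
    TopRep.res ((ContinuousMonoidHom.id (absoluteGaloisGroup K)) :
        absoluteGaloisGroup K →* absoluteGaloisGroup K) (DiscreteGaloisModule.mu K 2).toTopRep ⟶
      discreteTopRep (absoluteGaloisGroup K) (geomTorsion W 2) :=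
  TopRep.ofHom
    { toLinearMap := (W.muToTwoTorsion h).toIntLinearMap
      cont := continuous_of_discreteTopology
      isIntertwining' := fun σ ↦ ContinuousLinearMap.ext fun v => by
        exact W.muToTwoTorsion_smul h σ v }

/-- Values of the morphism `muToTwoTorsionHom`. [cite: SerreGaloisCohomology1997, I §2.4] -/
@[simp]
theorem muToTwoTorsionHom_hom_apply (h : W.toAffine.SplitTwoTorsion e₁ e₂ e₃) (v : MuCarrier K 2) :
    (W.muToTwoTorsionHom h).hom v = W.muToTwoTorsion h v :=
  rfl

/-- **`H¹(ι_{T₁}) : H¹(K, μ₂) →+ H¹(K, E[2])`**, the map on continuous cohomology induced by the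
equivariant section `ι_{T₁}`. [cite: SerreGaloisCohomology1997, I §2.4] -/
def muToTwoTorsionH1 (h : W.toAffine.SplitTwoTorsion e₁ e₂ e₃) : H1Mu K 2 →+ galH1Torsion W 2 :=
  (ContinuousCohomology.map (ContinuousMonoidHom.id (absoluteGaloisGroup K))
    (W.muToTwoTorsionHom h) 1).hom.toLinearMap.toAddMonoidHom

/-- **`H¹(ι_{T₁})` on explicit cocycles**: `[ψ] ↦ [ι_{T₁} ∘ ψ]`. [cite: SerreGaloisCohomology1997, I §2.4] -/
theorem muToTwoTorsionH1_oneCocycleClass (h : W.toAffine.SplitTwoTorsion e₁ e₂ e₃)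
    (ψ : contOneCocycles (DiscreteGaloisModule.mu K 2).toTopRep) :
    W.muToTwoTorsionH1 h (oneCocycleClass _ ψ) =
      oneCocycleClass _ (contOneCocycles.pullback (ContinuousMonoidHom.id (absoluteGaloisGroup K))
        (W.muToTwoTorsionHom h) ψ) := by
  unfold muToTwoTorsionH1
  simp only [LinearMap.toAddMonoidHom_coe, ContinuousLinearMap.coe_coe]
  exact map_oneCocycleClass _ (ContinuousMonoidHom.id (absoluteGaloisGroup K)) (W.muToTwoTorsionHom h) ψ

/-- **`H¹(χ₁) ∘ H¹(ι_{T₁}) = 0`.** [cite: SilvermanAEC2009, Thm. X.1.1, Prop. X.1.4] -/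
theorem twoTorsionCharH1_muToTwoTorsionH1_self (h : W.toAffine.SplitTwoTorsion e₁ e₂ e₃) (ξ : H1Mu K 2) :
    W.twoTorsionCharH1 h (W.muToTwoTorsionH1 h ξ) = 0 := by
  obtain ⟨ψ, rfl⟩ := oneCocycleClass_surjective _ ξ
  rw [muToTwoTorsionH1_oneCocycleClass, twoTorsionCharH1_oneCocycleClass, ← oneCocycleClass_zero]
  congr 1
  apply Subtype.ext
  ext σ : 1
  rw [contOneCocycles.pullback_apply, twoTorsionCharHom_hom_apply, contOneCocycles.pullback_apply,
    muToTwoTorsionHom_hom_apply]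
  exact W.twoTorsionChar_muToTwoTorsion_self h _

/-- **`H¹(χ₁) ∘ H¹(ι_{T'}) = id` for `T' ≠ T₁`.** [cite: SilvermanAEC2009, Thm. X.1.1, Prop. X.1.4] -/
theorem twoTorsionCharH1_muToTwoTorsionH1_of_ne (h : W.toAffine.SplitTwoTorsion e₁ e₂ e₃)
    {e₁' e₂' e₃' : K} (h' : W.toAffine.SplitTwoTorsion e₁' e₂' e₃') (hne : e₁ ≠ e₁') (ξ : H1Mu K 2) :
    W.twoTorsionCharH1 h (W.muToTwoTorsionH1 h' ξ) = ξ := by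
  obtain ⟨ψ, rfl⟩ := oneCocycleClass_surjective _ ξ
  rw [muToTwoTorsionH1_oneCocycleClass, twoTorsionCharH1_oneCocycleClass]
  congr 1
  apply Subtype.ext
  ext σ : 1
  rw [contOneCocycles.pullback_apply, twoTorsionCharHom_hom_apply, contOneCocycles.pullback_apply,
    muToTwoTorsionHom_hom_apply]
  exact W.twoTorsionChar_muToTwoTorsion_of_ne h h' hne _

/-! ### The class with prescribed components -/

/-- **The class of `H¹(K, E[2])` with components `([a], [b])`**:
`twoDescentClass h a b = H¹(ι_{T₂})(δ a) + H¹(ι_{T₁})(δ b)`, `δ : Kˣ → H¹(K, μ₂)` the Kummer map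
(`kummerMap K 2`) — the class of Silverman's homogeneous space `(b₁, b₂) = (a, b)` of Prop. X.1.4.
[cite: SilvermanAEC2009, Prop. X.1.4] -/
def twoDescentClass (h : W.toAffine.SplitTwoTorsion e₁ e₂ e₃) (a b : Kˣ) : galH1Torsion W 2 :=
  W.muToTwoTorsionH1 h.swap₁₂ (kummerMap K 2 a).toAdd + W.muToTwoTorsionH1 h (kummerMap K 2 b).toAdd

/-- The `T₁`-component of `twoDescentClass h a b` in `H¹(K, μ₂)` is the Kummer class of `a`.
[cite: SilvermanAEC2009, Prop. X.1.4] -/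
theorem twoTorsionCharH1_twoDescentClass (h : W.toAffine.SplitTwoTorsion e₁ e₂ e₃) (a b : Kˣ) :
    W.twoTorsionCharH1 h (W.twoDescentClass h a b) = (kummerMap K 2 a).toAdd := by
  rw [twoDescentClass, map_add, W.twoTorsionCharH1_muToTwoTorsionH1_of_ne h h.swap₁₂ h.ne₁₂,
    W.twoTorsionCharH1_muToTwoTorsionH1_self h, add_zero]

/-- The `T₂`-component of `twoDescentClass h a b` in `H¹(K, μ₂)` is the Kummer class of `b`.
[cite: SilvermanAEC2009, Prop. X.1.4] -/
theorem twoTorsionCharH1_swap_twoDescentClass (h : W.toAffine.SplitTwoTorsion e₁ e₂ e₃) (a b : Kˣ) :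
    W.twoTorsionCharH1 h.swap₁₂ (W.twoDescentClass h a b) = (kummerMap K 2 b).toAdd := by
  rw [twoDescentClass, map_add, W.twoTorsionCharH1_muToTwoTorsionH1_self h.swap₁₂,
    W.twoTorsionCharH1_muToTwoTorsionH1_of_ne h.swap₁₂ h h.ne₁₂.symm, zero_add]

/-- **`twoDescentClass h a b` has `T₁`-component `[a] ∈ Kˣ/Kˣ²`** (through Kummer theory
`kummerEquiv`). [cite: SilvermanAEC2009, Prop. X.1.4] -/
theorem kummerEquiv_twoTorsionCharH1_twoDescentClass (h : W.toAffine.SplitTwoTorsion e₁ e₂ e₃) (a b : Kˣ) :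
    kummerEquiv K 2 (W.twoTorsionCharH1 h (W.twoDescentClass h a b)) =
      Additive.ofMul (QuotientGroup.mk a) := by
  rw [twoTorsionCharH1_twoDescentClass, kummerEquiv_kummerMap]

/-- **`twoDescentClass h a b` has `T₂`-component `[b] ∈ Kˣ/Kˣ²`.** [cite: SilvermanAEC2009, Prop. X.1.4] -/
theorem kummerEquiv_twoTorsionCharH1_swap_twoDescentClass (h : W.toAffine.SplitTwoTorsion e₁ e₂ e₃)
    (a b : Kˣ) :
    kummerEquiv K 2 (W.twoTorsionCharH1 h.swap₁₂ (W.twoDescentClass h a b)) =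
      Additive.ofMul (QuotientGroup.mk b) := by
  rw [twoTorsionCharH1_swap_twoDescentClass, kummerEquiv_kummerMap]

/-- **Surjectivity of the components**: every pair `([a], [b]) ∈ (Kˣ/Kˣ²)²` is the pair of components
of a class of `H¹(K, E[2])` — so `(H¹(χ₁), H¹(χ₂))` followed by Kummer theory is a BIJECTION
`H¹(K, E[2]) ≃ (Kˣ/Kˣ²)²` (`E[2] ≅ μ₂ × μ₂`; injectivity is `eq_zero_of_twoTorsionCharH1_eq_zero`).
[cite: SilvermanAEC2009, Prop. X.1.4] -/
theorem exists_kummerEquiv_twoTorsionCharH1_eq (h : W.toAffine.SplitTwoTorsion e₁ e₂ e₃) (a b : Kˣ) :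
    ∃ c : galH1Torsion W 2,
      kummerEquiv K 2 (W.twoTorsionCharH1 h c) = Additive.ofMul (QuotientGroup.mk a) ∧
        kummerEquiv K 2 (W.twoTorsionCharH1 h.swap₁₂ c) = Additive.ofMul (QuotientGroup.mk b) :=
  ⟨W.twoDescentClass h a b, W.kummerEquiv_twoTorsionCharH1_twoDescentClass h a b,
    W.kummerEquiv_twoTorsionCharH1_swap_twoDescentClass h a b⟩

/-- **Uniqueness**: a class of `H¹(K, E[2])` with components `([a], [b])` IS `twoDescentClass h a b`.
[cite: SilvermanAEC2009, Prop. X.1.4] -/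
theorem eq_twoDescentClass_of_kummerEquiv_eq (h : W.toAffine.SplitTwoTorsion e₁ e₂ e₃) (a b : Kˣ)
    {c : galH1Torsion W 2}
    (ha : kummerEquiv K 2 (W.twoTorsionCharH1 h c) = Additive.ofMul (QuotientGroup.mk a))
    (hb : kummerEquiv K 2 (W.twoTorsionCharH1 h.swap₁₂ c) = Additive.ofMul (QuotientGroup.mk b)) :
    c = W.twoDescentClass h a b := by
  rw [← sub_eq_zero]
  refine W.eq_zero_of_twoTorsionCharH1_eq_zero h _ ?_ ?_
  · rw [map_sub, sub_eq_zero]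
    apply (kummerEquiv K 2).injective
    rw [ha, kummerEquiv_twoTorsionCharH1_twoDescentClass]
  · rw [map_sub, sub_eq_zero]
    apply (kummerEquiv K 2).injective
    rw [hb, kummerEquiv_twoTorsionCharH1_swap_twoDescentClass]

/-! ### Number fields: the local condition at the good odd places -/

section NumberField

open NumberField IsDedekindDomain

variable {K : Type u} [Field K] [NumberField K] (W : WeierstrassCurve K) [W.IsElliptic] {e₁ e₂ e₃ : K}

/-- **`H¹(ι_T)(δ a)` is Selmer at a good odd place where `a` is a unit.** Let `K` be a number field,
`v` a finite place of good reduction with `v ∤ 2`, and `a ∈ 𝓞 K` with `a ∉ v`. Then the class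
`H¹(ι_{T₁})(δ a) ∈ H¹(K, E[2])` lies in the local Selmer kernel at `v` (it dies in `H¹(K_v, E)`): its
cocycle `τ ↦ ι_{T₁}(τ(√a)/√a)` vanishes on every inertia group above `v`, because inertia fixes the
square roots of the `v`-unit `a` (`K(√a)/K` unramified at `v`, Lang *FDG* Ch. 6 Prop. 1.3), and at a
good place `v ∤ 2` a class vanishing on inertia satisfies the local Selmer condition (Gross 1991,
(7.1); Silverman Cor. X.4.4 converse). [cite: SilvermanAEC2009, Prop. X.1.4, Thm. X.4.2]
[cite: Lang1983, Ch. 6 Prop. 1.3] [cite: GrossLMS1991, §7 (7.1)] -/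
theorem muToTwoTorsionH1_kummerMap_mem_selmerLocalKer (h : W.toAffine.SplitTwoTorsion e₁ e₂ e₃)
    {v : HeightOneSpectrum (𝓞 K)} (hv : W.HasGoodReductionAt v) (h2 : (2 : 𝓞 K) ∉ v.asIdeal)
    {a : 𝓞 K} (hav : a ∉ v.asIdeal) (ha0 : (a : K) ≠ 0) :
    W.muToTwoTorsionH1 h (kummerMap K 2 (Units.mk0 (a : K) ha0)).toAdd ∈
      selmerLocalKer W (v.adicCompletion K) 2 := by
  obtain ⟨𝔓, h𝔓⟩ := v.primesAbove_nonempty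
  have hn : ((2 : ℤ) : 𝓞 K) ∉ v.asIdeal := by rwa [Int.cast_ofNat]
  rw [kummerMap_apply, kummerClassHom_apply, toAdd_ofAdd, muToTwoTorsionH1_oneCocycleClass,
    W.oneCocycleClass_mem_selmerLocalKer_iff hv hn h𝔓]
  intro τ hτ
  rw [contOneCocycles.pullback_apply, muToTwoTorsionHom_hom_apply]
  apply W.muToTwoTorsion_of_muVal_eq_one h
  set α : kummerUnits K 2 := kummerUnitsRoot K 2 (Units.mk0 (a : K) ha0) with hαdef
  have hα : (((α : kummerUnits K 2) : (AlgebraicClosure K)ˣ) : AlgebraicClosure K) ^ 2 =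
      algebraMap (𝓞 K) (AlgebraicClosure K) a := by
    have h1 := congrArg Units.val (kummerUnitsRoot_pow K 2 (Units.mk0 (a : K) ha0))
    rw [Units.val_pow_eq_pow_val, Units.coe_map, MonoidHom.coe_coe, Units.val_mk0] at h1
    rw [hαdef, h1, IsScalarTower.algebraMap_apply (𝓞 K) K (AlgebraicClosure K)]
  have hfix : τ • (((α : kummerUnits K 2) : (AlgebraicClosure K)ˣ) : AlgebraicClosure K) =
      ((α : kummerUnits K 2) : (AlgebraicClosure K)ˣ) :=
    absoluteGaloisGroup_inertia_fixes_root_of_not_mem v hav (by exact_mod_cast h2) hα h𝔓 hτ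
  change muVal K 2 (kummerOneCocycleFun K 2 α ((ContinuousMonoidHom.id (absoluteGaloisGroup K)) τ)) = 1
  rw [muVal_kummerOneCocycleFun, div_eq_one]
  ext
  rw [Units.coe_smul]
  exact hfix

/-- **The class of a pair of `v`-units is Selmer at a good odd place `v`** (Silverman AEC Prop. X.1.4:
for `v ∉ S`, every pair `(b₁, b₂)` of `v`-units modulo squares lies in the local image `δ(E(K_v))`):
for `K` a number field, `v ∤ 2` a place of good reduction and `a, b ∈ 𝓞 K` not in `v`,
`twoDescentClass h a b ∈ selmerLocalKer W (K_v) 2`. [cite: SilvermanAEC2009, Prop. X.1.4, Cor. X.4.4]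
[cite: Lang1983, Ch. 6 Prop. 1.3] -/
theorem twoDescentClass_mem_selmerLocalKer_of_not_mem (h : W.toAffine.SplitTwoTorsion e₁ e₂ e₃)
    {v : HeightOneSpectrum (𝓞 K)} (hv : W.HasGoodReductionAt v) (h2 : (2 : 𝓞 K) ∉ v.asIdeal)
    {a b : 𝓞 K} (hav : a ∉ v.asIdeal) (hbv : b ∉ v.asIdeal) (ha0 : (a : K) ≠ 0) (hb0 : (b : K) ≠ 0) :
    W.twoDescentClass h (Units.mk0 (a : K) ha0) (Units.mk0 (b : K) hb0) ∈
      selmerLocalKer W (v.adicCompletion K) 2 :=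
  add_mem (W.muToTwoTorsionH1_kummerMap_mem_selmerLocalKer h.swap₁₂ hv h2 hav ha0)
    (W.muToTwoTorsionH1_kummerMap_mem_selmerLocalKer h hv h2 hbv hb0)

end NumberField

end WeierstrassCurve

end
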